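import Summits.Ventures.LatticeQCDFlow.Scoring.U1TorusTopologicalSusceptibilityTwelfth
import Summits.Ventures.LatticeQCDFlow.Scoring.BesselIRatioLadder
import Summits.Ventures.LatticeQCDFlow.Scoring.RatioSeriesTailBounds
import Mathlib.Analysis.Real.Pi.Bounds
import HarnessLib

/-!
# A kernel-checkable certificate for `⟨Q²⟩` of 2-d `U(1)` on the torus

HONEST FRAMING: exact (Metropolis-corrected) sampling algorithms for lattice gauge theory;
figures of merit are autocorrelation/cost numbers at stated couplings and volumes; no
continuum-physics claim.

Venture `LatticeQCDFlow` (cell pub-lqcd), sub-topic `Scoring`; FANOUT row 5 (`s0-sun-a`), GEN-14.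
NEW WORK of the cell (placement rule).  `Scoring/U1TorusTopologicalSusceptibilityTwelfth.lean` gives
`⟨Q²⟩ = V/12 + (V/(4π²))·μ/z` (`V = L²`; `z = Σ_n r_{|n|}^V`,
`μ = Σ_n [2 r_{|n|}^{V−1} κ̃_n − (V−1) r_{|n|}^{V−2} σ̃_n²]`, `r_k = I_k(β)/I₀(β)`,
`σ̃_n, κ̃_n = Σ_m r_{|m|} (−1)^{n+m}/(n+m)^{1,2}`); `Scoring/BesselIRatioLadder.lean` encloses
`a_k ≤ r_k ≤ b_k` (`k ≤ M`); `Scoring/RatioSeriesTailBounds.lean` bounds every truncation at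
`|m|, |n| ≤ M` by `2T = 2 b_M θ/(1−θ)`, `θ = β/(2(M+1))`.  Here the RATIONAL certificate is assembled:
a Boolean term (no `def`) computing window sums `A1_n, A2_n` (proxies of `σ̃_n, κ̃_n` within
`η = (2M+1)ε + 2T`), bounds for each summand, for `μ`, `z`, the ratio and `V/(4π²)`
(`3.14159265358979323846 < π < …847`), and **`integral_topCharge_sq_mem_of_cert`**: the term `= true`
(with the ratio-ladder term) ⇒ `lo ≤ ∫ Q² dμ_{(ℤ/L)²,β} ≤ hi` (`β = x ∈ ℚ`).  Instances by
`decide +kernel`: `Scoring/U1TopSusceptibilityEnclosures.lean`.  Elementary; nothing is cited.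
-/

noncomputable section

open MeasureTheory Real Finset Filter Topology
open scoped ENNReal
open Literature.Analysis.FunctionSpaces
open Literature.MathematicalPhysics.QuantumFieldTheory
open Literature.MathematicalPhysics.QuantumLattice (u1Rep)
open Summit.Ventures.LatticeQCDFlow.Theory2.Lattice (topCharge)

namespace Summit.Ventures.LatticeQCDFlow.Scoring

/-! ### 1. Elementary interval lemmas -/

/-- Bounds for one summand `G = 2ρ^p κ − W ρ^q σ²` of `μ` from `ρ ∈ [a,b] ⊆ [0,∞)`, `|κ − A2| ≤ η`,
`|σ − A1| ≤ η`. -/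
theorem summand_mem {ρ a b κ σ A1 A2 η W : ℝ} {p q : ℕ} (ha0 : 0 ≤ a) (haρ : a ≤ ρ) (hρb : ρ ≤ b)
    (hκ : |κ - A2| ≤ η) (hσ : |σ - A1| ≤ η) (hη : 0 ≤ η) (hW : 0 ≤ W) :
    min (2 * a ^ p * A2) (2 * b ^ p * A2) - 2 * b ^ p * η - W * b ^ q * A1 ^ 2 -
        W * b ^ q * (η * (2 * |A1| + η)) ≤ 2 * ρ ^ p * κ - W * ρ ^ q * σ ^ 2 ∧
      2 * ρ ^ p * κ - W * ρ ^ q * σ ^ 2 ≤ max (2 * a ^ p * A2) (2 * b ^ p * A2) + 2 * b ^ p * η -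
        W * a ^ q * A1 ^ 2 + W * b ^ q * (η * (2 * |A1| + η)) := by
  have hρ0 : 0 ≤ ρ := ha0.trans haρ
  have hpa : a ^ p ≤ ρ ^ p := pow_le_pow_left₀ ha0 haρ p
  have hpb : ρ ^ p ≤ b ^ p := pow_le_pow_left₀ hρ0 hρb p
  have hqa : a ^ q ≤ ρ ^ q := pow_le_pow_left₀ ha0 haρ q
  have hqb : ρ ^ q ≤ b ^ q := pow_le_pow_left₀ hρ0 hρb q
  have hp0 : 0 ≤ ρ ^ p := pow_nonneg hρ0 p
  have hq0 : 0 ≤ ρ ^ q := pow_nonneg hρ0 q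
  obtain ⟨hκ1, hκ2⟩ := abs_le.1 hκ
  obtain ⟨hσ1, hσ2⟩ := abs_le.1 hσ
  -- `2ρ^p κ = 2ρ^p A2 + 2ρ^p (κ − A2)`
  have hk_lo : min (2 * a ^ p * A2) (2 * b ^ p * A2) - 2 * b ^ p * η ≤ 2 * ρ ^ p * κ := by
    have h1 : min (2 * a ^ p * A2) (2 * b ^ p * A2) ≤ 2 * ρ ^ p * A2 := by
      rcases le_or_gt 0 A2 with hA | hA
      · exact (min_le_left _ _).trans (by nlinarith)
      · exact (min_le_right _ _).trans (by nlinarith)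
    have h2 : -(2 * b ^ p * η) ≤ 2 * ρ ^ p * (κ - A2) := by nlinarith
    nlinarith
  have hk_hi : 2 * ρ ^ p * κ ≤ max (2 * a ^ p * A2) (2 * b ^ p * A2) + 2 * b ^ p * η := by
    have h1 : 2 * ρ ^ p * A2 ≤ max (2 * a ^ p * A2) (2 * b ^ p * A2) := by
      rcases le_or_gt 0 A2 with hA | hA
      · exact le_trans (by nlinarith) (le_max_right _ _)
      · exact le_trans (by nlinarith) (le_max_left _ _)
    have h2 : 2 * ρ ^ p * (κ - A2) ≤ 2 * b ^ p * η := by nlinarith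
    nlinarith
  -- `σ² = A1² + (σ − A1)(σ + A1)`, `|(σ − A1)(σ + A1)| ≤ η (2|A1| + η)`
  have hdev : |σ ^ 2 - A1 ^ 2| ≤ η * (2 * |A1| + η) := by
    rw [show σ ^ 2 - A1 ^ 2 = (σ - A1) * (σ + A1) by ring, abs_mul]
    refine mul_le_mul hσ ?_ (abs_nonneg _) hη
    calc |σ + A1| = |(σ - A1) + 2 * A1| := by ring_nf
      _ ≤ |σ - A1| + |2 * A1| := abs_add_le _ _
      _ ≤ η + 2 * |A1| := by rw [abs_mul, abs_two]; linarith
      _ = 2 * |A1| + η := by ring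
  obtain ⟨hd1, hd2⟩ := abs_le.1 hdev
  have hs_lo : W * a ^ q * A1 ^ 2 - W * b ^ q * (η * (2 * |A1| + η)) ≤ W * ρ ^ q * σ ^ 2 := by
    have h1 : W * a ^ q * A1 ^ 2 ≤ W * ρ ^ q * A1 ^ 2 := by
      have := mul_le_mul_of_nonneg_right hqa (sq_nonneg A1)
      nlinarith
    have h2 : -(W * b ^ q * (η * (2 * |A1| + η))) ≤ W * ρ ^ q * (σ ^ 2 - A1 ^ 2) := by
      have hE : 0 ≤ η * (2 * |A1| + η) := by positivity
      have h3 : W * ρ ^ q * (σ ^ 2 - A1 ^ 2) ≥ W * ρ ^ q * (-(η * (2 * |A1| + η))) :=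
        mul_le_mul_of_nonneg_left hd1 (mul_nonneg hW hq0)
      have h4 : W * ρ ^ q * (η * (2 * |A1| + η)) ≤ W * b ^ q * (η * (2 * |A1| + η)) :=
        mul_le_mul_of_nonneg_right (mul_le_mul_of_nonneg_left hqb hW) hE
      nlinarith
    nlinarith
  have hs_hi : W * ρ ^ q * σ ^ 2 ≤ W * b ^ q * A1 ^ 2 + W * b ^ q * (η * (2 * |A1| + η)) := by
    have h1 : W * ρ ^ q * A1 ^ 2 ≤ W * b ^ q * A1 ^ 2 := by
      have := mul_le_mul_of_nonneg_right hqb (sq_nonneg A1)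
      nlinarith
    have hE : 0 ≤ η * (2 * |A1| + η) := by positivity
    have h3 : W * ρ ^ q * (σ ^ 2 - A1 ^ 2) ≤ W * ρ ^ q * (η * (2 * |A1| + η)) :=
      mul_le_mul_of_nonneg_left hd2 (mul_nonneg hW hq0)
    have h4 : W * ρ ^ q * (η * (2 * |A1| + η)) ≤ W * b ^ q * (η * (2 * |A1| + η)) :=
      mul_le_mul_of_nonneg_right (mul_le_mul_of_nonneg_left hqb hW) hE
    nlinarith
  constructor <;> linarith

/-- `|2ρ^p κ − W ρ^q σ²| ≤ (2K + W K²)·ρ` for `ρ ∈ [0,1]`, `p, q ≥ 1`, `|κ|, |σ| ≤ K`. -/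
theorem abs_summand_le {ρ κ σ K W : ℝ} {p q : ℕ} (hp : 1 ≤ p) (hq : 1 ≤ q) (h0 : 0 ≤ ρ) (h1 : ρ ≤ 1)
    (hκ : |κ| ≤ K) (hσ : |σ| ≤ K) (hW : 0 ≤ W) :
    |2 * ρ ^ p * κ - W * ρ ^ q * σ ^ 2| ≤ (2 * K + W * K ^ 2) * ρ := by
  have hK : 0 ≤ K := (abs_nonneg _).trans hκ
  have hpow : ∀ {j : ℕ}, 1 ≤ j → ρ ^ j ≤ ρ := fun {j} hj => pow_le_of_le_one h0 h1 (by omega)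
  have hσ2 : σ ^ 2 ≤ K ^ 2 := by rw [← sq_abs]; exact pow_le_pow_left₀ (abs_nonneg _) hσ 2
  calc |2 * ρ ^ p * κ - W * ρ ^ q * σ ^ 2| ≤ |2 * ρ ^ p * κ| + |W * ρ ^ q * σ ^ 2| := abs_sub _ _
    _ = 2 * ρ ^ p * |κ| + W * ρ ^ q * σ ^ 2 := by
        have e1 : |2 * ρ ^ p * κ| = 2 * ρ ^ p * |κ| := by
          rw [abs_mul, abs_mul, abs_two, abs_of_nonneg (pow_nonneg h0 p)]
        have e2 : |W * ρ ^ q * σ ^ 2| = W * ρ ^ q * σ ^ 2 :=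
          abs_of_nonneg (mul_nonneg (mul_nonneg hW (pow_nonneg h0 q)) (sq_nonneg σ))
        rw [e1, e2]
    _ ≤ 2 * ρ * K + W * ρ * K ^ 2 := by
        have h3 : ρ ^ p * |κ| ≤ ρ * K := mul_le_mul (hpow hp) hκ (abs_nonneg _) h0
        have h4 : ρ ^ q * σ ^ 2 ≤ ρ * K ^ 2 := mul_le_mul (hpow hq) hσ2 (sq_nonneg _) h0
        nlinarith
    _ = (2 * K + W * K ^ 2) * ρ := by ring

/-- Division by `z ∈ [z₁, z₂]`, `z₁ > 0`: `min(μ₁/z₂, μ₁/z₁) ≤ μ/z ≤ max(μ₂/z₁, μ₂/z₂)`. -/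
theorem div_mem_of_mem {μ z μ₁ μ₂ z₁ z₂ : ℝ} (hz0 : 0 < z₁) (hz1 : z₁ ≤ z) (hz2 : z ≤ z₂)
    (hμ1 : μ₁ ≤ μ) (hμ2 : μ ≤ μ₂) :
    min (μ₁ / z₂) (μ₁ / z₁) ≤ μ / z ∧ μ / z ≤ max (μ₂ / z₁) (μ₂ / z₂) := by
  have hz : 0 < z := lt_of_lt_of_le hz0 hz1
  have hz2' : 0 < z₂ := lt_of_lt_of_le hz hz2
  have hl : μ₁ / z ≤ μ / z := div_le_div_of_nonneg_right hμ1 hz.le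
  have hu : μ / z ≤ μ₂ / z := div_le_div_of_nonneg_right hμ2 hz.le
  constructor
  · rcases le_or_gt 0 μ₁ with hm | hm
    · exact (min_le_left _ _).trans ((div_le_div_of_nonneg_left hm hz hz2).trans hl)
    · refine (min_le_right _ _).trans (le_trans ?_ hl)
      rw [div_le_div_iff₀ hz0 hz]; nlinarith
  · rcases le_or_gt 0 μ₂ with hm | hm
    · exact hu.trans ((div_le_div_of_nonneg_left hm hz0 hz1).trans (le_max_left _ _))
    · refine hu.trans (le_trans ?_ (le_max_right _ _))
      rw [div_le_div_iff₀ hz hz2']; nlinarith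

/-- The factor `V/(4π²)`: with `D ≤ π ≤ U`, `0 < D`, `0 ≤ V`,
`min(Vq₁/(4U²), Vq₁/(4D²)) ≤ V q/(4π²) ≤ max(Vq₂/(4D²), Vq₂/(4U²))` for `q ∈ [q₁, q₂]`. -/
theorem pi_factor_mem {q q₁ q₂ V D U : ℝ} (hD : 0 < D) (hDπ : D ≤ π) (hπU : π ≤ U) (hV : 0 ≤ V)
    (h1 : q₁ ≤ q) (h2 : q ≤ q₂) :
    min (V * q₁ / (4 * U ^ 2)) (V * q₁ / (4 * D ^ 2)) ≤ V / (4 * π ^ 2) * q ∧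
      V / (4 * π ^ 2) * q ≤ max (V * q₂ / (4 * D ^ 2)) (V * q₂ / (4 * U ^ 2)) := by
  have hπ : 0 < π := Real.pi_pos
  have hU : 0 < U := lt_of_lt_of_le hπ hπU
  have hD2 : 4 * D ^ 2 ≤ 4 * π ^ 2 := by nlinarith
  have hU2 : 4 * π ^ 2 ≤ 4 * U ^ 2 := by nlinarith
  rw [show V / (4 * π ^ 2) * q = V * q / (4 * π ^ 2) by ring]
  exact div_mem_of_mem (μ := V * q) (μ₁ := V * q₁) (μ₂ := V * q₂) (by positivity) hD2 hU2
    (mul_le_mul_of_nonneg_left h1 hV) (mul_le_mul_of_nonneg_left h2 hV)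

/-! ### 2. The Bessel ratios satisfy the hypotheses of the tail bounds -/

/-- The ratio sequence `r_k = I_k(x)/I₀(x)`: `0 ≤ r_k ≤ 1`, decay `r_{k+1} ≤ (x/(2(M+1))) r_k` for `k ≥ M`,
and `Σ_{m∈ℤ} r_{|m|} < ∞` (`x > 0`). -/
theorem besselRatioSeq_props {x : ℝ} (hx : 0 < x) (M : ℕ) :
    (∀ k, 0 ≤ besselI k x / besselI 0 x) ∧ (∀ k, besselI k x / besselI 0 x ≤ 1) ∧
      (∀ k, M ≤ k → besselI (k + 1) x / besselI 0 x ≤ x / (2 * (M + 1)) * (besselI k x / besselI 0 x)) ∧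
      Summable fun m : ℤ => besselI m.natAbs x / besselI 0 x := by
  have hI0 : 0 < besselI 0 x := besselI_pos 0 hx
  refine ⟨fun k => div_nonneg (besselI_pos k hx).le hI0.le,
    fun k => (div_le_one hI0).2 (besselI_le_besselI_zero k x), fun k hk => ?_,
    (summable_besselI_natAbs x).div_const _⟩
  have hIk : 0 < besselI k x := besselI_pos k hx
  obtain ⟨_, h2⟩ := besselI_ratio_succ_le k hx
  have hstep : besselI (k + 1) x ≤ x / (2 * (M + 1)) * besselI k x := by
    have h3 : besselI (k + 1) x ≤ x / (2 * (k + 1)) * besselI k x := by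
      rwa [div_le_iff₀ hIk] at h2
    refine h3.trans (mul_le_mul_of_nonneg_right ?_ hIk.le)
    have hk' : (M : ℝ) ≤ k := by exact_mod_cast hk
    exact div_le_div_of_nonneg_left hx.le (by positivity) (by linarith)
  rw [← mul_div_assoc]
  exact div_le_div_of_nonneg_right hstep hI0.le

/-! ### 3. The rescaled series -/

variable {L : ℕ} [NeZero L]

/-- **`⟨Q²⟩ = V/12 + (V/(4π²))·μ/z` in the ratios `r_k = I_k/I₀`** (`L ≥ 2`, `x > 0`, `V = L²`). -/
theorem integral_topCharge_sq_eq_ratio (hL : 2 ≤ L) {x : ℝ} (hx : 0 < x) :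
    ∫ U, (topCharge U) ^ 2 ∂(wilsonMeasure (d := 2) (L := L) u1Rep x) =
      (L : ℝ) ^ 2 / 12 + (L : ℝ) ^ 2 / (4 * π ^ 2) *
        ((∑' n : ℤ, (2 * (besselI n.natAbs x / besselI 0 x) ^ (L ^ 2 - 1) *
            (∑' k : ℤ, besselI k.natAbs x / besselI 0 x * ((-1 : ℝ) ^ (n + k) / ((n + k : ℤ) : ℝ) ^ 2)) -
          (L ^ 2 - 1 : ℕ) * (besselI n.natAbs x / besselI 0 x) ^ (L ^ 2 - 2) *
            (∑' k : ℤ, besselI k.natAbs x / besselI 0 x * ((-1 : ℝ) ^ (n + k) / (n + k : ℤ))) ^ 2)) /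
        ∑' n : ℤ, (besselI n.natAbs x / besselI 0 x) ^ (L ^ 2)) := by
  have hI0 : 0 < besselI 0 x := besselI_pos 0 hx
  have hV3 : 3 ≤ L ^ 2 := le_trans (by norm_num) (Nat.pow_le_pow_left hL 2)
  obtain ⟨w, hw⟩ := Nat.exists_eq_add_of_le' hV3
  set I0 := besselI 0 x with hI0def
  rw [integral_topCharge_sq_eq_twelfth_add x hL, hw, show w + 3 - 1 = w + 2 from rfl,
    show w + 3 - 2 = w + 1 from rfl]
  -- numerator and denominator are `I0^{w+3}` times the rescaled ones
  have hκ : ∀ n : ℤ, ∑' k : ℤ, besselI k.natAbs x * ((-1 : ℝ) ^ (n + k) / ((n + k : ℤ) : ℝ) ^ 2) =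
      I0 * ∑' k : ℤ, besselI k.natAbs x / I0 * ((-1 : ℝ) ^ (n + k) / ((n + k : ℤ) : ℝ) ^ 2) := by
    intro n; rw [← tsum_mul_left]; refine tsum_congr fun k => ?_; field_simp
  have hσ : ∀ n : ℤ, ∑' k : ℤ, besselI k.natAbs x * ((-1 : ℝ) ^ (n + k) / (n + k : ℤ)) =
      I0 * ∑' k : ℤ, besselI k.natAbs x / I0 * ((-1 : ℝ) ^ (n + k) / (n + k : ℤ)) := by
    intro n; rw [← tsum_mul_left]; refine tsum_congr fun k => ?_; field_simp
  have hN : ∑' n : ℤ, (2 * besselI n.natAbs x ^ (w + 2) *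
        (∑' k : ℤ, besselI k.natAbs x * ((-1 : ℝ) ^ (n + k) / ((n + k : ℤ) : ℝ) ^ 2)) -
      (w + 2 : ℕ) * besselI n.natAbs x ^ (w + 1) *
        (∑' k : ℤ, besselI k.natAbs x * ((-1 : ℝ) ^ (n + k) / (n + k : ℤ))) ^ 2) =
      I0 ^ (w + 3) * ∑' n : ℤ, (2 * (besselI n.natAbs x / I0) ^ (w + 2) *
        (∑' k : ℤ, besselI k.natAbs x / I0 * ((-1 : ℝ) ^ (n + k) / ((n + k : ℤ) : ℝ) ^ 2)) -
      (w + 2 : ℕ) * (besselI n.natAbs x / I0) ^ (w + 1) *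
        (∑' k : ℤ, besselI k.natAbs x / I0 * ((-1 : ℝ) ^ (n + k) / (n + k : ℤ))) ^ 2) := by
    rw [← tsum_mul_left]; refine tsum_congr fun n => ?_
    rw [hκ n, hσ n]
    have hI0' : I0 ≠ 0 := hI0.ne'
    generalize (∑' k : ℤ, besselI k.natAbs x / I0 * ((-1 : ℝ) ^ (n + k) / ((n + k : ℤ) : ℝ) ^ 2)) = K'
    generalize (∑' k : ℤ, besselI k.natAbs x / I0 * ((-1 : ℝ) ^ (n + k) / (n + k : ℤ))) = S'
    rw [div_pow, div_pow]
    field_simp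
    ring
  have hZ : ∑' n : ℤ, besselI n.natAbs x ^ (w + 3) = I0 ^ (w + 3) * ∑' n : ℤ, (besselI n.natAbs x / I0) ^ (w + 3) := by
    rw [← tsum_mul_left]; refine tsum_congr fun n => ?_
    have hI0' : I0 ≠ 0 := hI0.ne'
    rw [div_pow, mul_div_cancel₀ _ (pow_ne_zero _ hI0')]
  rw [hN, hZ, mul_div_assoc, mul_div_mul_left _ _ (pow_ne_zero _ hI0.ne')]

/-! ### 4. Soundness of the certificate -/

/-- **SOUNDNESS OF THE `⟨Q²⟩` CERTIFICATE.**  Data: `x ∈ ℚ` (= `β`), the ratio order `M`, tables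
`ρd, rd` as in `Scoring/BesselIRatioLadder.lean`, a width `ε`, and claimed bounds `lo, hi`.  If the
ratio-ladder term and the certificate term below both evaluate to `true`, then
`lo ≤ ∫ Q² dμ_{(ℤ/L)²,β} ≤ hi`.  The certificate term computes (all in `ℚ`, `V = L²`):
`θ = x/(2(M+1))`, `T2 = 2 b_M θ/(1−θ)`, `η = (2M+1)ε + T2`, `K = Σ_i b_{|i−M|} + T2`,
`C = 2K + (V−1)K²`, window sums `A1_i, A2_i` of `a_{|j−M|}·(−1)^{n+m}/(n+m)^{1,2}` (`n = i−M`,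
`m = j−M`), summand bounds as in `summand_mem`, `μ`-bounds `Σ_i low_i − C·T2`, `Σ_i upp_i + C·T2`,
`z`-bounds `Σ_i a^V`, `Σ_i b^V + T2`, the ratio by `div_mem_of_mem` and `V/(4π²)` by `pi_factor_mem`
with `3.14159265358979323846 ≤ π ≤ 3.14159265358979323847`. -/
theorem integral_topCharge_sq_mem_of_cert (hL : 2 ≤ L) {x ε lo hi : ℚ} {M : ℕ} {ρd rd : ℕ → ℚ × ℚ}
    (hratio : (decide (0 < x) && decide (ρd (M + 1) = (0, x / (2 * (M + 1)))) && decide (rd 0 = (1, 1)) &&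
      (List.range M).all (fun i =>
        decide (0 ≤ (ρd (i + 1)).1) && decide (0 ≤ (ρd (i + 2)).1) &&
        decide ((ρd (i + 1)).1 * (2 * (i + 1 : ℕ) / x + (ρd (i + 2)).2) ≤ 1) &&
        decide (1 ≤ (ρd (i + 1)).2 * (2 * (i + 1 : ℕ) / x + (ρd (i + 2)).1)) &&
        decide (0 ≤ (rd (i + 1)).1) && decide ((rd (i + 1)).1 ≤ (rd i).1 * (ρd (i + 1)).1) &&
        decide ((rd i).2 * (ρd (i + 1)).2 ≤ (rd (i + 1)).2))) = true)
    (hcert : (let V : ℕ := L ^ 2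
      let θ : ℚ := x / (2 * (M + 1))
      let T2 : ℚ := 2 * ((rd M).2 * θ / (1 - θ))
      let η : ℚ := (2 * M + 1) * ε + T2
      let K : ℚ := (∑ i ∈ Finset.range (2 * M + 1), (rd ((i : ℤ) - M).natAbs).2) + T2
      let C : ℚ := 2 * K + ((V - 1 : ℕ) : ℚ) * K ^ 2
      let A1 : ℕ → ℚ := fun i => ∑ j ∈ Finset.range (2 * M + 1),
        (rd ((j : ℤ) - M).natAbs).1 *
          ((-1 : ℚ) ^ (((i : ℤ) - M) + ((j : ℤ) - M)) / ((((i : ℤ) - M) + ((j : ℤ) - M) : ℤ) : ℚ))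
      let A2 : ℕ → ℚ := fun i => ∑ j ∈ Finset.range (2 * M + 1),
        (rd ((j : ℤ) - M).natAbs).1 *
          ((-1 : ℚ) ^ (((i : ℤ) - M) + ((j : ℤ) - M)) / ((((i : ℤ) - M) + ((j : ℤ) - M) : ℤ) : ℚ) ^ 2)
      let av : ℕ → ℚ := fun i => (rd ((i : ℤ) - M).natAbs).1
      let bv : ℕ → ℚ := fun i => (rd ((i : ℤ) - M).natAbs).2
      let low : ℕ → ℚ := fun i =>
        min (2 * av i ^ (V - 1) * A2 i) (2 * bv i ^ (V - 1) * A2 i) - 2 * bv i ^ (V - 1) * η -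
          ((V - 1 : ℕ) : ℚ) * bv i ^ (V - 2) * A1 i ^ 2 -
          ((V - 1 : ℕ) : ℚ) * bv i ^ (V - 2) * (η * (2 * |A1 i| + η))
      let upp : ℕ → ℚ := fun i =>
        max (2 * av i ^ (V - 1) * A2 i) (2 * bv i ^ (V - 1) * A2 i) + 2 * bv i ^ (V - 1) * η -
          ((V - 1 : ℕ) : ℚ) * av i ^ (V - 2) * A1 i ^ 2 +
          ((V - 1 : ℕ) : ℚ) * bv i ^ (V - 2) * (η * (2 * |A1 i| + η))
      let μ₁ : ℚ := (∑ i ∈ Finset.range (2 * M + 1), low i) - C * T2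
      let μ₂ : ℚ := (∑ i ∈ Finset.range (2 * M + 1), upp i) + C * T2
      let z₁ : ℚ := ∑ i ∈ Finset.range (2 * M + 1), av i ^ V
      let z₂ : ℚ := (∑ i ∈ Finset.range (2 * M + 1), bv i ^ V) + T2
      let q₁ : ℚ := min (μ₁ / z₂) (μ₁ / z₁)
      let q₂ : ℚ := max (μ₂ / z₁) (μ₂ / z₂)
      let D : ℚ := 3.14159265358979323846
      let U : ℚ := 3.14159265358979323847
      let Q₁ : ℚ := (V : ℚ) / 12 + min ((V : ℚ) * q₁ / (4 * U ^ 2)) ((V : ℚ) * q₁ / (4 * D ^ 2))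
      let Q₂ : ℚ := (V : ℚ) / 12 + max ((V : ℚ) * q₂ / (4 * D ^ 2)) ((V : ℚ) * q₂ / (4 * U ^ 2))
      decide (0 < x) && decide (x < 2 * (M + 1)) && decide (0 ≤ ε) &&
        (List.range (M + 1)).all (fun k => decide ((rd k).2 - (rd k).1 ≤ ε)) &&
        decide (0 < z₁) && decide (lo ≤ Q₁) && decide (Q₂ ≤ hi)) = true) :
    ((lo : ℚ) : ℝ) ≤ ∫ U, (topCharge U) ^ 2 ∂(wilsonMeasure (d := 2) (L := L) u1Rep ((x : ℚ) : ℝ)) ∧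
      ∫ U, (topCharge U) ^ 2 ∂(wilsonMeasure (d := 2) (L := L) u1Rep ((x : ℚ) : ℝ)) ≤ ((hi : ℚ) : ℝ) := by
  -- unpack the certificate
  simp only [Bool.and_eq_true, decide_eq_true_eq, List.all_eq_true, List.mem_range] at hcert
  obtain ⟨⟨⟨⟨⟨⟨hx0, hxM⟩, hε0⟩, hwid⟩, hz0⟩, hlo⟩, hhi⟩ := hcert
  -- the real objects
  have hx' : (0 : ℝ) < ((x : ℚ) : ℝ) := by exact_mod_cast hx0
  have hV4 : 4 ≤ L ^ 2 := le_trans (by norm_num) (Nat.pow_le_pow_left hL 2)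
  have hp1 : 1 ≤ L ^ 2 - 1 := by omega
  have hq1 : 1 ≤ L ^ 2 - 2 := by omega
  set r : ℕ → ℝ := fun k => besselI k ((x : ℚ) : ℝ) / besselI 0 ((x : ℚ) : ℝ) with hr
  set a : ℕ → ℝ := fun k => (((rd k).1 : ℚ) : ℝ) with ha
  set b : ℕ → ℝ := fun k => (((rd k).2 : ℚ) : ℝ) with hb
  set θ : ℝ := ((x : ℚ) : ℝ) / (2 * (M + 1)) with hθ
  obtain ⟨h0, h1, hdec', hs⟩ := besselRatioSeq_props hx' M
  have hdec : ∀ k, M ≤ k → r (k + 1) ≤ θ * r k := fun k hk => hdec' k hk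
  have hθ0 : 0 ≤ θ := by rw [hθ]; positivity
  have hθ1 : θ < 1 := by
    rw [hθ, div_lt_one (by positivity)]
    have : ((x : ℚ) : ℝ) < ((2 * (M + 1) : ℚ) : ℝ) := by exact_mod_cast hxM
    push_cast at this
    exact this
  have hab : ∀ k, k ≤ M → a k ≤ r k ∧ r k ≤ b k := fun k hk => by
    obtain ⟨_, h2, h3⟩ := besselRatio_sound hratio k hk
    exact ⟨h2, h3⟩
  have ha0 : ∀ k, k ≤ M → 0 ≤ a k := fun k hk => (besselRatio_sound hratio k hk).1
  have hεR : ∀ k, k ≤ M → b k - a k ≤ ((ε : ℚ) : ℝ) := fun k hk => by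
    have := hwid k (by omega)
    show (((rd k).2 : ℚ) : ℝ) - (((rd k).1 : ℚ) : ℝ) ≤ ((ε : ℚ) : ℝ)
    exact_mod_cast this
  have hεR0 : (0 : ℝ) ≤ ((ε : ℚ) : ℝ) := by exact_mod_cast hε0
  -- the tail constant and the proxies
  set T : ℝ := b M * θ / (1 - θ) with hT
  have hT0 : 0 ≤ T := by
    rw [hT]; exact div_nonneg (mul_nonneg ((h0 M).trans (hab M le_rfl).2) hθ0) (by linarith)
  set η : ℝ := (2 * M + 1) * ((ε : ℚ) : ℝ) + 2 * T with hη
  have hη0 : 0 ≤ η := by positivity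
  set K : ℝ := ∑ i ∈ Finset.range (2 * M + 1), b ((i : ℤ) - M).natAbs + 2 * T with hK
  set W : ℝ := ((L ^ 2 - 1 : ℕ) : ℝ) with hW
  have hW0 : 0 ≤ W := by positivity
  set A1 : ℕ → ℝ := fun i => ∑ j ∈ Finset.range (2 * M + 1), a ((j : ℤ) - M).natAbs *
    ((-1 : ℝ) ^ (((i : ℤ) - M) + ((j : ℤ) - M)) / ((((i : ℤ) - M) + ((j : ℤ) - M) : ℤ) : ℝ)) with hA1
  set A2 : ℕ → ℝ := fun i => ∑ j ∈ Finset.range (2 * M + 1), a ((j : ℤ) - M).natAbs *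
    ((-1 : ℝ) ^ (((i : ℤ) - M) + ((j : ℤ) - M)) / ((((i : ℤ) - M) + ((j : ℤ) - M) : ℤ) : ℝ) ^ 2) with hA2
  set low : ℕ → ℝ := fun i =>
    min (2 * a ((i : ℤ) - M).natAbs ^ (L ^ 2 - 1) * A2 i) (2 * b ((i : ℤ) - M).natAbs ^ (L ^ 2 - 1) * A2 i) -
      2 * b ((i : ℤ) - M).natAbs ^ (L ^ 2 - 1) * η -
      W * b ((i : ℤ) - M).natAbs ^ (L ^ 2 - 2) * A1 i ^ 2 -
      W * b ((i : ℤ) - M).natAbs ^ (L ^ 2 - 2) * (η * (2 * |A1 i| + η)) with hlow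
  set upp : ℕ → ℝ := fun i =>
    max (2 * a ((i : ℤ) - M).natAbs ^ (L ^ 2 - 1) * A2 i) (2 * b ((i : ℤ) - M).natAbs ^ (L ^ 2 - 1) * A2 i) +
      2 * b ((i : ℤ) - M).natAbs ^ (L ^ 2 - 1) * η -
      W * a ((i : ℤ) - M).natAbs ^ (L ^ 2 - 2) * A1 i ^ 2 +
      W * b ((i : ℤ) - M).natAbs ^ (L ^ 2 - 2) * (η * (2 * |A1 i| + η)) with hupp
  -- `κ̃_n`, `σ̃_n` truncations and bounds
  have hc1 : ∀ n j : ℤ, |(-1 : ℝ) ^ (n + j) / ((n + j : ℤ) : ℝ)| ≤ 1 := fun n j =>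
    abs_neg_one_zpow_div_le (n + j)
  have hc2 : ∀ n j : ℤ, |(-1 : ℝ) ^ (n + j) / ((n + j : ℤ) : ℝ) ^ 2| ≤ 1 := fun n j =>
    abs_neg_one_zpow_div_sq_le (n + j)
  have hσ_tr : ∀ i : ℕ, |∑' m : ℤ, r m.natAbs * ((-1 : ℝ) ^ (((i : ℤ) - M) + m) / ((((i : ℤ) - M) + m : ℤ) : ℝ)) -
      A1 i| ≤ η := fun i =>
    abs_tsum_sub_truncation_le h0 hdec hθ0 hθ1 hab hεR hs (hc1 _)
  have hκ_tr : ∀ i : ℕ, |∑' m : ℤ, r m.natAbs * ((-1 : ℝ) ^ (((i : ℤ) - M) + m) / ((((i : ℤ) - M) + m : ℤ) : ℝ) ^ 2) -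
      A2 i| ≤ η := fun i =>
    abs_tsum_sub_truncation_le h0 hdec hθ0 hθ1 hab hεR hs (hc2 _)
  have hσ_bd : ∀ n : ℤ, |∑' m : ℤ, r m.natAbs * ((-1 : ℝ) ^ (n + m) / ((n + m : ℤ) : ℝ))| ≤ K := fun n =>
    abs_tsum_le_bound h0 hdec hθ0 hθ1 hab hs (hc1 n)
  have hκ_bd : ∀ n : ℤ, |∑' m : ℤ, r m.natAbs * ((-1 : ℝ) ^ (n + m) / ((n + m : ℤ) : ℝ) ^ 2)| ≤ K := fun n =>
    abs_tsum_le_bound h0 hdec hθ0 hθ1 hab hs (hc2 n)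
  have hK0 : 0 ≤ K := (abs_nonneg _).trans (hσ_bd 0)
  -- the summands of `μ`
  set G : ℤ → ℝ := fun n => 2 * r n.natAbs ^ (L ^ 2 - 1) *
      (∑' k : ℤ, r k.natAbs * ((-1 : ℝ) ^ (n + k) / ((n + k : ℤ) : ℝ) ^ 2)) -
    W * r n.natAbs ^ (L ^ 2 - 2) * (∑' k : ℤ, r k.natAbs * ((-1 : ℝ) ^ (n + k) / (n + k : ℤ))) ^ 2
    with hG
  have hGabs : ∀ n, |G n| ≤ (2 * K + W * K ^ 2) * r n.natAbs := fun n =>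
    abs_summand_le hp1 hq1 (h0 _) (h1 _) (hκ_bd n) (hσ_bd n) hW0
  have hC0 : 0 ≤ 2 * K + W * K ^ 2 := by positivity
  have hμ_tr := abs_tsum_sub_sum_le_of_abs_le h0 hdec hθ0 hθ1 (hab M le_rfl).2 hs hC0 hGabs
  have hz := tsum_pow_mem h0 h1 hdec hθ0 hθ1 hab ha0 hs (by omega : 1 ≤ L ^ 2)
  have hGi : ∀ i, i ∈ Finset.range (2 * M + 1) → low i ≤ G ((i : ℤ) - M) ∧ G ((i : ℤ) - M) ≤ upp i := by
    intro i hi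
    have hk : ((i : ℤ) - M).natAbs ≤ M := by simp at hi; omega
    exact summand_mem (ha0 _ hk) (hab _ hk).1 (hab _ hk).2 (hκ_tr i) (hσ_tr i) hη0 hW0
  have hsumlo : ∑ i ∈ Finset.range (2 * M + 1), low i ≤ ∑ i ∈ Finset.range (2 * M + 1), G ((i : ℤ) - M) :=
    Finset.sum_le_sum fun i hi => (hGi i hi).1
  have hsumhi : ∑ i ∈ Finset.range (2 * M + 1), G ((i : ℤ) - M) ≤ ∑ i ∈ Finset.range (2 * M + 1), upp i :=
    Finset.sum_le_sum fun i hi => (hGi i hi).2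
  have hμlo := (abs_le.1 hμ_tr).1
  have hμhi := (abs_le.1 hμ_tr).2
  -- the formula, the ratio and the `π` factor
  rw [integral_topCharge_sq_eq_ratio hL hx']
  have hz0R : (0 : ℝ) < ∑ i ∈ Finset.range (2 * M + 1), a ((i : ℤ) - M).natAbs ^ (L ^ 2) := by
    have h := hz0
    simp only [ha]
    exact_mod_cast h
  have hdiv := div_mem_of_mem
    (μ := ∑' n : ℤ, G n) (z := ∑' m : ℤ, r m.natAbs ^ (L ^ 2))
    (μ₁ := ∑ i ∈ Finset.range (2 * M + 1), low i - (2 * K + W * K ^ 2) * (2 * T))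
    (μ₂ := ∑ i ∈ Finset.range (2 * M + 1), upp i + (2 * K + W * K ^ 2) * (2 * T))
    (z₁ := ∑ i ∈ Finset.range (2 * M + 1), a ((i : ℤ) - M).natAbs ^ (L ^ 2))
    (z₂ := ∑ i ∈ Finset.range (2 * M + 1), b ((i : ℤ) - M).natAbs ^ (L ^ 2) + 2 * T)
    hz0R hz.1 hz.2 (by linarith) (by linarith)
  have hπfac := pi_factor_mem (V := ((L : ℝ)) ^ 2) (D := (3.14159265358979323846 : ℝ))
    (U := (3.14159265358979323847 : ℝ)) (by norm_num) Real.pi_gt_d20.le Real.pi_lt_d20.le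
    (by positivity) hdiv.1 hdiv.2
  -- compare with the kernel's rational numbers
  have hloR := (Rat.cast_le (K := ℝ)).mpr hlo
  have hhiR := (Rat.cast_le (K := ℝ)).mpr hhi
  simp only [hr, ha, hb, hθ, hT, hK, hW, hG, hη, hA1, hA2, hlow, hupp] at hπfac
  push_cast at hloR hhiR hπfac ⊢
  constructor
  · linarith [hπfac.1, hloR]
  · linarith [hπfac.2, hhiR]

end Summit.Ventures.LatticeQCDFlow.Scoring
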